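import Literature.Geometry.Lorentzian.CarterFarEnvelope
import Literature.Geometry.Lorentzian.CarterFluxEnvelopes
import Literature.Geometry.Lorentzian.CarterThresholdBarrierGeometry
import Literature.Analysis.ODE.BarrierDepth
import Literature.Analysis.ODE.BarrierInwardGrowth
import HarnessLib

/-!
# The angular barrier of Carter's radial equation at large `Λ`: inverse-square rate, outer turning
# point, depth, and the power decay of the recessive branch
(namespace `Literature.Geometry.Lorentzian.Kerr`.)

Carter's radial equation of the separated wave equation on a sub-extremal Kerr exterior reads, in a
tortoise variable, `u″ + (ω² − V(ρ x))u = 0`, `V = Kerr.sepPotential M a ω m Λ`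
(Dafermos–Rodnianski–Shlapentokh-Rothman arXiv:1402.7034, §5.2.3). For an admissible triple the
angular term dominates the potential far from the horizon, `V(r) ≥ Λ/(3r²)` on `r ≥ 7M`
(`third_div_sq_le_sepPotential`), so that whenever `256·ω²R_Λ² ≤ Λ` the whole range
`7M ≤ r ≤ 2R_Λ` is classically FORBIDDEN with the inverse-square rate

  `V(r) − ω² ≥ Λ/(4r²)`   (`angularBarrier_rate`).

Along a tortoise radius `ρ` this file records the geometry of that ANGULAR BARRIER consumed by the
two-point decay estimate of the cone Green kernel (near-extremal Kerr programme):

* `exists_angular_turningPoint` — beyond a point `x₂` of the far zone where the coefficient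
  `φ = ω² − V∘ρ` is `≤ 0` there is an outer turning point `β ≥ x₂`, `φ(β) = 0`, with `φ ≤ 0` on the far
  zone left of `β`, `φ ≥ 0` on `[β, ∞)` (`φ` is non-decreasing on `ρ ≥ 7M`) and
  `ρ β ≤ R_far = max(7M, √(12Λ)/|ω|, 1/(Mω²))`;
* `rpow_mul_le_of_angularBarrier` — POWER DECAY of the recessive branch: for a positive
  non-increasing solution `d` of `d″ = (V∘ρ − ω²)d` on `[x_b, β]` (`ρ x_b ≥ 7M`, `ρ x₂ = 2R_Λ`, `x₂ ≤ β`)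
  and `x_b ≤ y` with `ρ y ≤ R_Λ`: `d(y)·ρ(y)^{√Λ/8} ≤ d(x_b)·ρ(x_b)^{√Λ/8}` — at every `s` the dyadic
  shell `[ρ s, 2ρ s]` certifies the recessive rate `−d′/d ≥ √Λ/(8ρ s)` (`tanh_mul_le_neg_deriv`; the
  tortoise length of a shell dominates its radial length), integrated against the weight `ρ`
  (`mul_rpow_le_mul_rpow_of_rate`, `dρ/dx ≤ 1`);
* `depth_and_endRate_of_angularBarrier` — for the growing branch `g ≥ 1`, `g′ ≥ 0` on `[x_b, β]`:
  `g′(β) ≥ √Λ/(2R_Λ)` and `g(β) ≤ ((β − x₂) + 8R_Λ/√Λ)·g′(β)` from the good shell `[R_Λ, 2R_Λ]`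
  (`depth_of_good_interval`, `growing_end_rate`).

## References
* M. Dafermos, I. Rodnianski, Y. Shlapentokh-Rothman, arXiv:1402.7034 = Ann. of Math. 183 (2016),
  §5.2.3, §6.2, §8.4; key `DafermosRodnianskiShlapentokhrothman2014`.
* P. Hartman, *Ordinary Differential Equations* (SIAM Classics 38, 2002), Ch. XI §§3, 6. Key
  `Hartman2002`. The assembly is folklore.
-/

noncomputable section

open Filter Set Literature.Analysis.ODE
open scoped Topology

namespace Literature.Geometry.Lorentzian

namespace Kerr

/-! ### The angular term dominates the potential on `r ≥ 7M` -/

/-- **`V(r) ≥ Λ/(3r²)` for `r ≥ 7M`** (`0 < M`, `|a| ≤ M`, admissible `(ω, m, Λ)`): in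
`V₀ = (4Mr·amω − a²m² + ΔΛ)/(r² + a²)²` one has `4Mr·amω ≥ −2MrΛ`, `a²m² ≤ a²Λ`, hence the numerator is
`≥ Λ(r² − 4Mr)`, and `(r² + a²)² ≤ 3r²(r² − 4Mr)` for `r ≥ 7M`; `V₁ ≥ 0`.
[cite: DafermosRodnianskiShlapentokhrothman2014, §6.2] -/
theorem third_div_sq_le_sepPotential {M a ω Λ r : ℝ} {m : ℤ} (hM : 0 < M) (haM : |a| ≤ M)
    (hadm : IsAdmissibleTriple a ω m Λ) (hr : 7 * M ≤ r) :
    Λ / (3 * r ^ 2) ≤ sepPotential M a ω m Λ r := by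
  have hΛ : 0 ≤ Λ := hadm.nonneg
  have ha2 : a ^ 2 ≤ M ^ 2 := by nlinarith [sq_abs a, abs_nonneg a]
  have hr0 : 0 < r := by linarith
  have hrp : rPlus M a ≤ r := (rPlus_le_two_mul_self hM.le a).trans (by linarith)
  have hV1 : 0 ≤ sepPotential₁ M a r := sepPotential₁_nonneg haM hrp
  have hD : 0 < r ^ 2 + a ^ 2 := by positivity
  suffices h : Λ / (3 * r ^ 2) ≤ sepPotential₀ M a ω m Λ r by
    unfold sepPotential; linarith
  unfold sepPotential₀ delta
  rw [div_le_div_iff₀ (by positivity) (pow_pos hD 2)]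
  -- the numerator is at least `Λ (r² − 4Mr)`
  have h1 : -(2 * M * r * Λ) ≤ 4 * M * r * a * m * ω := by
    have e : 4 * M * r * a * m * ω = 4 * M * r * (a * m * ω) := by ring
    rw [e]
    have := neg_abs_le (a * m * ω)
    nlinarith [hadm.2, mul_pos hM hr0]
  have h2 : a ^ 2 * (m : ℝ) ^ 2 ≤ a ^ 2 * Λ := mul_le_mul_of_nonneg_left hadm.sq_le (sq_nonneg a)
  have hN : Λ * (r ^ 2 - 4 * M * r) ≤
      4 * M * r * a * m * ω - a ^ 2 * (m : ℝ) ^ 2 + (r ^ 2 - 2 * M * r + a ^ 2) * Λ := by nlinarith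
  -- the polynomial inequality `(r² + a²)² ≤ 3r²(r² − 4Mr)` on `r ≥ 7M`
  have hpoly : (r ^ 2 + a ^ 2) ^ 2 ≤ 3 * r ^ 2 * (r ^ 2 - 4 * M * r) := by
    obtain ⟨s, hs, rfl⟩ : ∃ s, 0 ≤ s ∧ r = 7 * M + s := ⟨r - 7 * M, by linarith, by ring⟩
    have e : 3 * (7 * M + s) ^ 2 * ((7 * M + s) ^ 2 - 4 * M * (7 * M + s)) -
        ((7 * M + s) ^ 2 + M ^ 2) ^ 2 =
        587 * M ^ 4 + 952 * M ^ 3 * s + 334 * M ^ 2 * s ^ 2 + 44 * M * s ^ 3 + 2 * s ^ 4 := by ring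
    have h3 : ((7 * M + s) ^ 2 + a ^ 2) ^ 2 ≤ ((7 * M + s) ^ 2 + M ^ 2) ^ 2 :=
      pow_le_pow_left₀ hD.le (by linarith) 2
    have h4 : 0 ≤ 587 * M ^ 4 + 952 * M ^ 3 * s + 334 * M ^ 2 * s ^ 2 + 44 * M * s ^ 3 + 2 * s ^ 4 := by
      positivity
    linarith
  calc Λ * (r ^ 2 + a ^ 2) ^ 2 ≤ Λ * (3 * r ^ 2 * (r ^ 2 - 4 * M * r)) :=
        mul_le_mul_of_nonneg_left hpoly hΛ
    _ = Λ * (r ^ 2 - 4 * M * r) * (3 * r ^ 2) := by ring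
    _ ≤ (4 * M * r * a * m * ω - a ^ 2 * (m : ℝ) ^ 2 + (r ^ 2 - 2 * M * r + a ^ 2) * Λ) *
        (3 * r ^ 2) := mul_le_mul_of_nonneg_right hN (by positivity)
    _ = (4 * M * r * a * ↑m * ω - a ^ 2 * ↑m ^ 2 + (r ^ 2 - 2 * M * r + a ^ 2) * Λ) * (3 * r ^ 2) := by
        ring

/-- **The angular barrier.** If `256·ω²R_Λ² ≤ Λ` then `V(r) − ω² ≥ Λ/(4r²)` for every
`7M ≤ r ≤ 2R_Λ` (`ω²r² ≤ 4ω²R_Λ² ≤ Λ/64` and `V ≥ Λ/(3r²)`). [folklore] -/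
theorem angularBarrier_rate {M a ω Λ RΛ r : ℝ} {m : ℤ} (hM : 0 < M) (haM : |a| ≤ M)
    (hadm : IsAdmissibleTriple a ω m Λ) (hΛ : 256 * (ω ^ 2 * RΛ ^ 2) ≤ Λ) (hr : 7 * M ≤ r)
    (hrR : r ≤ 2 * RΛ) : Λ / (4 * r ^ 2) ≤ sepPotential M a ω m Λ r - ω ^ 2 := by
  have hV := third_div_sq_le_sepPotential hM haM hadm hr
  have hr0 : 0 < r := by linarith
  have hr2 : 0 < r ^ 2 := by positivity
  have hω : ω ^ 2 * r ^ 2 ≤ Λ / 64 := by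
    have h1 : r ^ 2 ≤ (2 * RΛ) ^ 2 := pow_le_pow_left₀ hr0.le hrR 2
    nlinarith [mul_le_mul_of_nonneg_left h1 (sq_nonneg ω)]
  have hω' : ω ^ 2 ≤ Λ / 64 / r ^ 2 := by rwa [le_div_iff₀ hr2]
  have hX : 0 ≤ Λ / r ^ 2 := div_nonneg hadm.nonneg hr2.le
  have e1 : Λ / (4 * r ^ 2) = Λ / r ^ 2 / 4 := div_mul_eq_div_div_swap _ _ _
  have e2 : Λ / (3 * r ^ 2) = Λ / r ^ 2 / 3 := div_mul_eq_div_div_swap _ _ _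
  have e3 : Λ / 64 / r ^ 2 = Λ / r ^ 2 / 64 := div_right_comm _ _ _
  rw [e1]; rw [e2] at hV; rw [e3] at hω'
  linarith

/-! ### The outer turning point -/

section Tortoise

variable {M a ω Λ : ℝ} {m : ℤ} {ρ : ℝ → ℝ}

/-- **The outer turning point of the angular barrier.** Let `ρ x₂ ≥ 7M` with
`ω² − V(ρ x₂) ≤ 0`, `ω ≠ 0`. Since `φ = ω² − V∘ρ` is continuous, non-decreasing on `ρ ≥ 7M` and tends
to `ω² > 0`, there is `β ≥ x₂` with `φ(β) = 0`, `φ(s) ≤ 0` for `ρ s ≥ 7M`, `s ≤ β`, `φ ≥ 0` on `[β, ∞)`,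
and `ρ β ≤ max(7M, √(12Λ)/|ω|, 1/(Mω²))` (where `φ ≥ ω²/2`). [cite: DafermosRodnianskiShlapentokhrothman2014, Prop. 8.4.1 (proof)] -/
theorem exists_angular_turningPoint (hρ : IsTortoiseRadius M a ρ) (hMa : IsSubextremal M a)
    (hadm : IsAdmissibleTriple a ω m Λ) (hω : ω ≠ 0) {x₂ : ℝ} (hx₂ : 7 * M ≤ ρ x₂)
    (hφ₂ : ω ^ 2 - sepPotential M a ω m Λ (ρ x₂) ≤ 0) :
    ∃ β, x₂ ≤ β ∧ ω ^ 2 - sepPotential M a ω m Λ (ρ β) = 0 ∧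
      (∀ s, 7 * M ≤ ρ s → s ≤ β → ω ^ 2 - sepPotential M a ω m Λ (ρ s) ≤ 0) ∧
      (∀ s, β ≤ s → 0 ≤ ω ^ 2 - sepPotential M a ω m Λ (ρ s)) ∧
      ρ β ≤ max (7 * M) (max (Real.sqrt (12 * Λ) / |ω|) (1 / (M * ω ^ 2))) := by
  set φ : ℝ → ℝ := fun y ↦ ω ^ 2 - sepPotential M a ω m Λ (ρ y) with hφ
  have hcont : Continuous φ := continuous_iff_continuousAt.2 fun s ↦
    (hρ.hasDerivAt_omega_sq_sub_sepPotential hMa ω m Λ s).continuousAt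
  have hω2 : 0 < ω ^ 2 := by positivity
  -- `φ → ω² > 0`: a point `T ≥ x₂` with `φ T > 0`
  have hlim : Tendsto φ atTop (𝓝 (ω ^ 2)) := by
    have h := (tendsto_const_nhds (x := ω ^ 2)).sub (hρ.tendsto_sepPotential_atTop hMa hadm)
    rw [sub_zero] at h
    exact h
  obtain ⟨T₀, hT₀⟩ : ∃ T₀, ∀ y ≥ T₀, 0 < φ y := eventually_atTop.1 (hlim.eventually_const_lt hω2)
  set T := max T₀ x₂ with hT
  have hφT : 0 < φ T := hT₀ T (le_max_left _ _)
  have hx₂T : x₂ ≤ T := le_max_right _ _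
  -- intermediate value
  obtain ⟨β, hβI, hβ0⟩ : ∃ β ∈ Icc x₂ T, φ β = 0 :=
    intermediate_value_Icc hx₂T hcont.continuousOn ⟨hφ₂, hφT.le⟩
  have hmono : ∀ s, 7 * M ≤ ρ s → MonotoneOn φ (Ici s) := fun s hs ↦
    carter_coeff_monotoneOn_far hρ hMa hadm hs
  refine ⟨β, hβI.1, hβ0, fun s hs hsβ ↦ ?_, fun s hs ↦ ?_, ?_⟩
  · have h := hmono s hs self_mem_Ici hsβ hsβ
    rw [hβ0] at h; exact h
  · have h := hmono x₂ hx₂ (show x₂ ≤ β from hβI.1) (hβI.1.trans hs) hs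
    rw [hβ0] at h; exact h
  · refine le_of_not_gt fun h ↦ ?_
    have := half_sq_le_omega_sq_sub_sepPotential hMa hω hadm h.le
    have e : ω ^ 2 - sepPotential M a ω m Λ (ρ β) = 0 := hβ0
    linarith

/-! ### Power decay of the recessive branch across the angular barrier -/

-- a private copy of `IsTortoiseRadius.deriv_le_one` (Literature/Geometry/Lorentzian/KerrFlatRangeWeight.lean), to keep the imports light
/-- `dρ/dx = Δ/(ρ² + a²) ≤ 1`. [cite: DafermosRodnianskiShlapentokhrothman2014, §2.1.2] -/
private theorem tortoise_deriv_le_one (hρ : IsTortoiseRadius M a ρ) (hMa : IsSubextremal M a) (x : ℝ) :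
    delta M a (ρ x) / (ρ x ^ 2 + a ^ 2) ≤ 1 := by
  have hA : 0 < ρ x ^ 2 + a ^ 2 := hρ.sq_add_sq_pos hMa x
  rw [div_le_one hA]
  unfold delta
  nlinarith [hρ.pos hMa x, hMa.pos]

/-- **Power decay of the recessive branch across the angular barrier.** Let `256·ω²R_Λ² ≤ Λ`,
`Λ ≥ 16`, `ρ x_b ≥ 7M`, `ρ x₂ = 2R_Λ`, `x₂ ≤ β`, and let `d` solve `d″ = (V∘ρ − ω²)·d` on `[x_b, β]` with
`d ≥ 1`, `d′ ≤ 0` there. Then for `x_b ≤ y`, `ρ y ≤ R_Λ`: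
`d(y)·ρ(y)^{√Λ/8} ≤ d(x_b)·ρ(x_b)^{√Λ/8}`. At each `s ∈ [x_b, y]` the shell `[s, s⁺]`, `ρ s⁺ = 2ρ s`
(inside `[x_b, β]`, tortoise length `≥ ρ s`, coefficient `≥ Λ/(16ρ(s)²)`) gives
`−d′(s) ≥ (√Λ/(4ρ s))·tanh(√Λ/4)·d(s) ≥ (√Λ/(8ρ s))·d(s)`, which is integrated against the weight `ρ`
(`dρ/dx ≤ 1`). [folklore] -/
theorem rpow_mul_le_of_angularBarrier (hρ : IsTortoiseRadius M a ρ) (hMa : IsSubextremal M a)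
    (hadm : IsAdmissibleTriple a ω m Λ) {RΛ : ℝ} (hΛ : 256 * (ω ^ 2 * RΛ ^ 2) ≤ Λ) (hΛ16 : 16 ≤ Λ)
    {d d' : ℝ → ℝ} {xb x₂ β : ℝ} (h7 : 7 * M ≤ ρ xb) (hx₂ : ρ x₂ = 2 * RΛ) (hx₂β : x₂ ≤ β)
    (hd : ∀ s ∈ Icc xb β, HasDerivAt d (d' s) s ∧
      HasDerivAt d' ((sepPotential M a ω m Λ (ρ s) - ω ^ 2) * d s) s)
    (hsign : ∀ s ∈ Icc xb β, 1 ≤ d s ∧ d' s ≤ 0) {y : ℝ} (hy : xb ≤ y) (hyR : ρ y ≤ RΛ) :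
    d y * ρ y ^ (Real.sqrt Λ / 8) ≤ d xb * ρ xb ^ (Real.sqrt Λ / 8) := by
  have hM : 0 < M := hMa.pos
  have haM : |a| ≤ M := le_of_lt hMa
  have hmono := (hρ.strictMono hMa).monotone
  have hsΛ : 4 ≤ Real.sqrt Λ := by
    rw [show (4 : ℝ) = Real.sqrt (4 ^ 2) by rw [Real.sqrt_sq (by norm_num)]]
    exact Real.sqrt_le_sqrt (by linarith)
  -- `y < x₂ ≤ β`
  have hyx₂ : y ≤ x₂ := by
    rw [← hρ.le_iff_le hMa, hx₂]; linarith [hρ.pos hMa y]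
  have hyβ : y ≤ β := hyx₂.trans hx₂β
  have hsub : Icc xb y ⊆ Icc xb β := Icc_subset_Icc_right hyβ
  refine mul_rpow_le_mul_rpow_of_rate (r := ρ) (r' := fun s ↦ delta M a (ρ s) / (ρ s ^ 2 + a ^ 2)) hy
    (fun s hs ↦ (hd s (hsub hs)).1) (fun s _ ↦ hρ.hasDerivAt s)
    (fun s hs ↦ zero_lt_one.trans_le (hsign s (hsub hs)).1) (fun s _ ↦ hρ.pos hMa s) fun s hs ↦ ?_
  -- the shell `[s, s⁺]`, `ρ s⁺ = 2 ρ s`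
  have hρs : 0 < ρ s := hρ.pos hMa s
  have h2s : rPlus M a < 2 * ρ s := by linarith [hρ.rPlus_lt s]
  obtain ⟨t, ht⟩ := hρ.exists_apply_eq h2s
  have hst : s ≤ t := by rw [← hρ.le_iff_le hMa, ht]; linarith
  have htx₂ : t ≤ x₂ := by
    rw [← hρ.le_iff_le hMa, ht, hx₂]
    linarith [hmono hs.2]
  have hsubI : Icc s t ⊆ Icc xb β := Icc_subset_Icc hs.1 (htx₂.trans hx₂β)
  set k := Real.sqrt Λ / (4 * ρ s) with hk
  have hk0 : 0 < k := by positivity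
  -- coefficient `≥ k²` on the shell
  have hqk : ∀ σ ∈ Icc s t, k ^ 2 ≤ sepPotential M a ω m Λ (ρ σ) - ω ^ 2 := by
    intro σ hσ
    have hσ7 : 7 * M ≤ ρ σ := h7.trans (hmono (hs.1.trans hσ.1))
    have hσ2 : ρ σ ≤ 2 * ρ s := by rw [← ht]; exact hmono hσ.2
    have hσR : ρ σ ≤ 2 * RΛ := by
      have : ρ s ≤ RΛ := (hmono hs.2).trans hyR
      linarith
    have hrate := angularBarrier_rate hM haM hadm hΛ hσ7 hσR
    have hρσ : 0 < ρ σ := hρ.pos hMa σ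
    have h1 : k ^ 2 ≤ Λ / (4 * ρ σ ^ 2) := by
      rw [hk, div_pow, Real.sq_sqrt hadm.nonneg, div_le_div_iff₀ (by positivity) (by positivity)]
      have : ρ σ ^ 2 ≤ (2 * ρ s) ^ 2 := pow_le_pow_left₀ hρσ.le hσ2 2
      nlinarith [hadm.nonneg]
    exact h1.trans hrate
  -- the recessive rate at `s`
  have hrate := tanh_mul_le_neg_deriv (fun σ hσ ↦ hd σ (hsubI hσ)) hqk
    (fun σ hσ ↦ zero_le_one.trans (hsign σ (hsubI hσ)).1) (hsign t (hsubI (right_mem_Icc.2 hst))).2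
    s (left_mem_Icc.2 hst)
  -- `k (t − s) ≥ k ρ s = √Λ/4 ≥ 1`, so `tanh ≥ 1/2`
  have hlen : ρ s ≤ t - s := by
    have := hρ.apply_sub_apply_le_sub hMa hst
    rw [ht] at this; linarith
  have hkl : 1 ≤ k * (t - s) := by
    calc (1 : ℝ) ≤ Real.sqrt Λ / 4 := by linarith
      _ = k * ρ s := by rw [hk]; field_simp
      _ ≤ k * (t - s) := mul_le_mul_of_nonneg_left hlen hk0.le
  have htanh : 1 / 2 ≤ Real.tanh (k * (t - s)) :=
    Literature.Barriers.HubbardSuperconductivity.half_le_tanh hkl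
  have hds : 0 ≤ d s := zero_le_one.trans (hsign s (hsubI (left_mem_Icc.2 hst))).1
  have hρ' : delta M a (ρ s) / (ρ s ^ 2 + a ^ 2) ≤ 1 := tortoise_deriv_le_one hρ hMa s
  have hρ'0 : 0 ≤ delta M a (ρ s) / (ρ s ^ 2 + a ^ 2) := (hρ.deriv_pos hMa s).le
  -- `p ρ′/ρ ≤ √Λ/(8 ρ s) = k/2 ≤ k tanh`
  have h1 : Real.sqrt Λ / 8 * (delta M a (ρ s) / (ρ s ^ 2 + a ^ 2)) / ρ s ≤
      k * Real.tanh (k * (t - s)) := by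
    calc Real.sqrt Λ / 8 * (delta M a (ρ s) / (ρ s ^ 2 + a ^ 2)) / ρ s
        ≤ Real.sqrt Λ / 8 * 1 / ρ s := by gcongr
      _ = k * (1 / 2) := by rw [hk]; field_simp; ring
      _ ≤ k * Real.tanh (k * (t - s)) := mul_le_mul_of_nonneg_left htanh hk0.le
  calc Real.sqrt Λ / 8 * (delta M a (ρ s) / (ρ s ^ 2 + a ^ 2)) / ρ s * d s
      ≤ k * Real.tanh (k * (t - s)) * d s := mul_le_mul_of_nonneg_right h1 hds
    _ ≤ -d' s := hrate

/-! ### Depth and the outer end rate of the growing branch -/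

/-- **Depth and outer reciprocal rate of the angular barrier.** Let `256·ω²R_Λ² ≤ Λ`, `Λ ≥ 64`,
`ρ x_b ≥ 7M`, `x_b ≤ x₁`, `ρ x₁ = R_Λ`, `ρ x₂ = 2R_Λ`, `x₂ ≤ β`, and let `g` solve `g″ = (V∘ρ − ω²)·g` on
`[x_b, β]` with the coefficient `≥ 0` there and `g ≥ 1`, `g′ ≥ 0`. Then `g′(β) ≥ √Λ/(2R_Λ)` and
`g(β) ≤ ((β − x₂) + 8R_Λ/√Λ)·g′(β)` (good shell `[x₁, x₂]`: rate `k = √Λ/(4R_Λ)`, `k(x₂ − x₁) ≥ √Λ/4 ≥ 2`,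
`sinh y ≥ y`, `1/(k tanh) ≤ 2/k`). [folklore] -/
theorem depth_and_endRate_of_angularBarrier (hρ : IsTortoiseRadius M a ρ) (hMa : IsSubextremal M a)
    (hadm : IsAdmissibleTriple a ω m Λ) {RΛ : ℝ} (hΛ : 256 * (ω ^ 2 * RΛ ^ 2) ≤ Λ) (hΛ64 : 64 ≤ Λ)
    {g g' : ℝ → ℝ} {xb x₁ x₂ β : ℝ} (h7 : 7 * M ≤ ρ xb) (hxb : xb ≤ x₁) (hx₁ : ρ x₁ = RΛ)
    (hx₂ : ρ x₂ = 2 * RΛ) (hx₂β : x₂ ≤ β)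
    (hg : ∀ s ∈ Icc xb β, HasDerivAt g (g' s) s ∧
      HasDerivAt g' ((sepPotential M a ω m Λ (ρ s) - ω ^ 2) * g s) s)
    (hq0 : ∀ s ∈ Icc xb β, 0 ≤ sepPotential M a ω m Λ (ρ s) - ω ^ 2)
    (hsign : ∀ s ∈ Icc xb β, 1 ≤ g s ∧ 0 ≤ g' s) :
    Real.sqrt Λ / (2 * RΛ) ≤ g' β ∧ g β ≤ ((β - x₂) + 8 * RΛ / Real.sqrt Λ) * g' β := by
  have hM : 0 < M := hMa.pos
  have haM : |a| ≤ M := le_of_lt hMa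
  have hmono := (hρ.strictMono hMa).monotone
  have hRΛ : 0 < RΛ := by rw [← hx₁]; exact hρ.pos hMa x₁
  have hsΛ : 8 ≤ Real.sqrt Λ := by
    rw [show (8 : ℝ) = Real.sqrt (8 ^ 2) by rw [Real.sqrt_sq (by norm_num)]]
    exact Real.sqrt_le_sqrt (by linarith)
  have hx₁₂ : x₁ < x₂ := by rw [← hρ.lt_iff_lt hMa, hx₁, hx₂]; linarith
  set k := Real.sqrt Λ / (4 * RΛ) with hk
  have hk0 : 0 < k := by positivity
  -- coefficient `≥ k²` on the good shell `[x₁, x₂]`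
  have hqk : ∀ σ ∈ Icc x₁ x₂, k ^ 2 ≤ sepPotential M a ω m Λ (ρ σ) - ω ^ 2 := by
    intro σ hσ
    have hσ7 : 7 * M ≤ ρ σ := h7.trans (hmono (hxb.trans hσ.1))
    have hσ2 : ρ σ ≤ 2 * RΛ := by rw [← hx₂]; exact hmono hσ.2
    have hrate := angularBarrier_rate hM haM hadm hΛ hσ7 hσ2
    have hρσ : 0 < ρ σ := hρ.pos hMa σ
    have h1 : k ^ 2 ≤ Λ / (4 * ρ σ ^ 2) := by
      rw [hk, div_pow, Real.sq_sqrt hadm.nonneg, div_le_div_iff₀ (by positivity) (by positivity)]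
      have : ρ σ ^ 2 ≤ (2 * RΛ) ^ 2 := pow_le_pow_left₀ hρσ.le hσ2 2
      nlinarith [hadm.nonneg]
    exact h1.trans hrate
  -- `k (x₂ − x₁) ≥ √Λ/4 ≥ 2`
  have hlen : RΛ ≤ x₂ - x₁ := by
    have := hρ.apply_sub_apply_le_sub hMa hx₁₂.le
    rw [hx₁, hx₂] at this; linarith
  have hkl : 2 ≤ k * (x₂ - x₁) := by
    calc (2 : ℝ) ≤ Real.sqrt Λ / 4 := by linarith
      _ = k * RΛ := by rw [hk]; field_simp
      _ ≤ k * (x₂ - x₁) := mul_le_mul_of_nonneg_left hlen hk0.le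
  have hg1 : ∀ s ∈ Icc xb β, 1 ≤ g s := fun s hs ↦ (hsign s hs).1
  have hg0 : ∀ s ∈ Icc xb β, 0 ≤ g s := fun s hs ↦ zero_le_one.trans (hsign s hs).1
  have hg'0 : ∀ s ∈ Icc xb β, 0 ≤ g' s := fun s hs ↦ (hsign s hs).2
  constructor
  · -- depth: `k sinh(k(x₂ − x₁)) ≤ g′ β`, `sinh y ≥ y ≥ 2`
    have h1 := depth_of_good_interval hg hq0 hg1 hg'0 hxb hx₁₂ hx₂β hk0 hqk
    have h2 : k * (x₂ - x₁) ≤ Real.sinh (k * (x₂ - x₁)) := Real.self_le_sinh_iff.2 (by linarith)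
    calc Real.sqrt Λ / (2 * RΛ) = k * 2 := by rw [hk]; field_simp; ring
      _ ≤ k * (k * (x₂ - x₁)) := mul_le_mul_of_nonneg_left hkl hk0.le
      _ ≤ k * Real.sinh (k * (x₂ - x₁)) := mul_le_mul_of_nonneg_left h2 hk0.le
      _ ≤ g' β := h1
  · have h1 := growing_end_rate hg hq0 hg0 hg'0 hxb hx₁₂ hx₂β hk0 hqk
    obtain ⟨-, hinv⟩ := tanh_rate_pos_and_inv_le hk0 (sub_pos.2 hx₁₂)
    have h2 : 1 / (k * Real.tanh (k * (x₂ - x₁))) ≤ 8 * RΛ / Real.sqrt Λ := by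
      calc 1 / (k * Real.tanh (k * (x₂ - x₁))) ≤ 2 / k := hinv (by linarith)
        _ = 8 * RΛ / Real.sqrt Λ := by rw [hk]; field_simp; ring
    have hg'β : 0 ≤ g' β := hg'0 β (right_mem_Icc.2 (hxb.trans (hx₁₂.le.trans hx₂β)))
    calc g β ≤ ((β - x₂) + 1 / (k * Real.tanh (k * (x₂ - x₁)))) * g' β := h1
      _ ≤ ((β - x₂) + 8 * RΛ / Real.sqrt Λ) * g' β := by gcongr

end Tortoise

end Kerr

end Literature.Geometry.Lorentzian

end
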